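import Mathlib.Combinatorics.Enumerative.DoubleCounting
import Mathlib.Combinatorics.SimpleGraph.Metric
import Mathlib.Combinatorics.SimpleGraph.Walk.Counting
import Summits.CriticalPhenomena.SAWScalingLimit.Theorems.SAWTotalPositivityBoundaryTP2Defs
import HarnessLib

/-!
# Crux `BoundaryTP2` (stmt-CriticalPhenomena-7115): geodesic counts of an interlaced quadruple are TP₂

The leading order in the fugacity `x` of the crux's inequality `Z(p₁,p₃)Z(p₂,p₄) ≤ Z(p₁,p₂)Z(p₃,p₄)`
(`Z = pathKernel H x`) is `Z(a,b) = N(a,b)·x^{d(a,b)} + O(x^{d(a,b)+1})` with `d = H.dist` and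
`N(a,b) = #(H.finsetWalkLength (d a b) a b)` the number of geodesics (a walk of length `dist` is
self-avoiding, `Walk.isPath_of_length_eq_dist`). The four-point file
(`SAWTotalPositivityBoundaryTP2FourPoint`, `interlaced_dist_add_dist_le`) shows `d₁₂ + d₃₄ ≤ d₁₃ + d₂₄`
for interlaced quadruples; this file treats the EQUALITY case `d₁₃ + d₂₄ = d₁₂ + d₃₄` and proves, on ANY
simple graph, `N₁₃ · N₂₄ ≤ N₁₂ · N₃₄` (`interlaced_geodesicCount_mul_le`): the leading coefficients of the
two sides of TP₂ compare correctly too, so the content of the conjecture lies entirely in the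
`x_c`-dependent tail.

Proof (first-meeting switch = an injection of geodesic pairs). Geodesics `P : p₁ → p₃`, `Q : p₂ → p₄`
meet (interlacing); let `w` be the FIRST vertex of `P` lying on `Q` (`exists_first_mem`). Re-pair at `w`:
`out₁ = P|→w · (Q|→w)⁻¹ : p₁ → p₂`, `out₂ = (P|w→)⁻¹ · Q|w→ : p₃ → p₄` (Mathlib `Walk.takeUntil`,
`Walk.dropUntil`). The lengths add up to `d₁₃ + d₂₄ = d₁₂ + d₃₄` while `|out₁| ≥ d₁₂`, `|out₂| ≥ d₃₄`
(`dist_le`), so both outputs are geodesics. Injectivity: `w` is recovered from the output as the first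
vertex of `out₁` lying on `out₂` (`first_mem_switch`: a vertex of `P` strictly before `w` is neither on
`Q` — first-ness — nor on `P|w→` — `P` is self-avoiding; first vertices are unique, `first_mem_unique`),
and then the four half-walks are recovered by append-cancellation (`walk_append_inj`; the split point of
`out₂` is known because `|P| = d₁₃` is). The counting step is Mathlib's relational injection principle
`Finset.card_le_card_of_forall_subsingleton`. All statements are about walks with explicit
`takeUntil`/`dropUntil` terms; no definitions are introduced. [folklore]
-/

namespace Summit.CriticalPhenomena.SAWScalingLimit.Theorems.BoundaryTP2

open SimpleGraph

variable {V : Type*} {H : SimpleGraph V} {p₁ p₂ p₃ p₄ : V}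

/-- Append-cancellation for walks: `p · q = p' · q'` with `|p| = |p'|` forces `p = p'` and `q = q'`
(via `List.append_inj` on the supports and `Walk.ext_support`). [folklore] -/
theorem walk_append_inj {u v x : V} {p p' : H.Walk u v} {q q' : H.Walk v x}
    (h : p.append q = p'.append q') (hl : p.length = p'.length) : p = p' ∧ q = q' := by
  have hs : p.support ++ q.support.tail = p'.support ++ q'.support.tail := by
    rw [← Walk.support_append, ← Walk.support_append, h]
  have hl' : p.support.length = p'.support.length := by
    rw [Walk.length_support, Walk.length_support, hl]
  obtain ⟨h₁, h₂⟩ := List.append_inj hs hl'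
  exact ⟨Walk.ext_support h₁,
    Walk.ext_support (by rw [← q.cons_tail_support, ← q'.cons_tail_support, h₂])⟩

section Switch

variable [DecidableEq V] {a b c d : V}

/-- On a self-avoiding path `P ∋ w`, the initial segment `P|→w` and the final segment `P|w→` meet only
at `w` (the support of `P = P|→w · P|w→` has no duplicates). [folklore] -/
theorem eq_of_mem_support_takeUntil_of_mem_support_dropUntil {w x : V} {P : H.Walk a c}
    (hPp : P.IsPath) (hP : w ∈ P.support) (hx : x ∈ (P.takeUntil w hP).support)
    (hx' : x ∈ (P.dropUntil w hP).support) : x = w := by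
  have hnd : ((P.takeUntil w hP).append (P.dropUntil w hP)).support.Nodup := by
    rw [P.take_spec hP]
    exact hPp.support_nodup
  rw [Walk.support_append] at hnd
  rw [← Walk.cons_tail_support, List.mem_cons] at hx'
  rcases hx' with h | h
  · exact h
  · exact ((List.disjoint_of_nodup_append hnd) hx h).elim

/-- A walk `P` that visits a list `l` has a FIRST vertex in `l`: some `w ∈ l` on `P` such that every
vertex of the initial segment `P|→w` lying in `l` is `w` itself (induction on `P`). [folklore] -/
theorem exists_first_mem (P : H.Walk a c) (l : List V) {v : V} (hv : v ∈ P.support) (hvl : v ∈ l) :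
    ∃ w, ∃ hw : w ∈ P.support, w ∈ l ∧ ∀ x ∈ (P.takeUntil w hw).support, x ∈ l → x = w := by
  induction P with
  | nil =>
    rw [Walk.mem_support_nil_iff] at hv
    subst hv
    exact ⟨_, Walk.start_mem_support _, hvl, fun x hx _ => by simpa using hx⟩
  | @cons a' b' c' hadj P ih =>
    by_cases ha : a' ∈ l
    · exact ⟨a', Walk.start_mem_support _, ha, fun x hx _ => by simpa using hx⟩
    · have hv' : v ∈ P.support := by
        rw [Walk.support_cons, List.mem_cons] at hv
        exact hv.resolve_left (by rintro rfl; exact ha hvl)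
      obtain ⟨w, hw, hwl, hf⟩ := ih hv'
      have hne : a' ≠ w := by rintro rfl; exact ha hwl
      have hw' : w ∈ (Walk.cons hadj P).support := by
        rw [Walk.support_cons]
        exact List.mem_cons_of_mem _ hw
      refine ⟨w, hw', hwl, fun x hx hxl => ?_⟩
      rw [Walk.takeUntil_cons hw hne hadj, Walk.support_cons, List.mem_cons] at hx
      rcases hx with rfl | hx
      · exact (ha hxl).elim
      · exact hf x hx hxl

/-- The first vertex of a walk `R` in a list `l` is unique: of two candidates, the initial segment up to
one is a prefix of the initial segment up to the other (`Walk.support_takeUntil_prefix_support`,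
`List.prefix_or_prefix_of_prefix`). [folklore] -/
theorem first_mem_unique {R : H.Walk a b} {l : List V} {w w' : V} (hw : w ∈ R.support)
    (hw' : w' ∈ R.support) (hl : w ∈ l) (hl' : w' ∈ l)
    (hf : ∀ x ∈ (R.takeUntil w hw).support, x ∈ l → x = w)
    (hf' : ∀ x ∈ (R.takeUntil w' hw').support, x ∈ l → x = w') : w = w' := by
  rcases List.prefix_or_prefix_of_prefix (R.support_takeUntil_prefix_support hw)
      (R.support_takeUntil_prefix_support hw') with hp | hp
  · exact hf' w (hp.subset (Walk.end_mem_support _)) hl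
  · exact (hf w' (hp.subset (Walk.end_mem_support _)) hl').symm

/-- The two outputs `out₁ = P|→w · (Q|→w)⁻¹`, `out₂ = (P|w→)⁻¹ · Q|w→` of the switch of `P`, `Q` at a
common vertex `w` have total length `|P| + |Q|`. [folklore] -/
theorem length_switch_add {w : V} (P : H.Walk a c) (Q : H.Walk b d) (hP : w ∈ P.support)
    (hQ : w ∈ Q.support) :
    ((P.takeUntil w hP).append (Q.takeUntil w hQ).reverse).length +
        ((P.dropUntil w hP).reverse.append (Q.dropUntil w hQ)).length = P.length + Q.length := by
  have hPl : (P.takeUntil w hP).length + (P.dropUntil w hP).length = P.length := by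
    rw [← Walk.length_append, Walk.take_spec]
  have hQl : (Q.takeUntil w hQ).length + (Q.dropUntil w hQ).length = Q.length := by
    rw [← Walk.length_append, Walk.take_spec]
  simp only [Walk.length_append, Walk.length_reverse]
  omega

/-- The initial segment of `out₁ = P|→w · (Q|→w)⁻¹` up to `w` is `P|→w`
(`Walk.takeUntil_append_of_mem_left`, `Walk.takeUntil_takeUntil`). [folklore] -/
theorem takeUntil_switch {w : V} (P : H.Walk a c) (Q : H.Walk b d) (hP : w ∈ P.support)
    (hQ : w ∈ Q.support) (h : w ∈ ((P.takeUntil w hP).append (Q.takeUntil w hQ).reverse).support) :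
    ((P.takeUntil w hP).append (Q.takeUntil w hQ).reverse).takeUntil w h = P.takeUntil w hP := by
  have := Walk.takeUntil_append_of_mem_left (P.takeUntil w hP) (Q.takeUntil w hQ).reverse
    (Walk.end_mem_support _)
  rw [Walk.takeUntil_takeUntil] at this
  exact this

/-- Recovery of the switching vertex: if `P` is self-avoiding and `w` is the first vertex of `P` on `Q`,
then every vertex of `out₁|→w = P|→w` lying on `out₂ = (P|w→)⁻¹ · Q|w→` is `w` — it is on `P|→w` and
either on `P|w→` (then it is `w`, `P` being a path) or on `Q|w→ ⊆ Q` (then it is `w` by first-ness).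
[folklore] -/
theorem first_mem_switch {w x : V} {P : H.Walk a c} {Q : H.Walk b d} (hPp : P.IsPath)
    (hP : w ∈ P.support) (hQ : w ∈ Q.support)
    (hf : ∀ x ∈ (P.takeUntil w hP).support, x ∈ Q.support → x = w)
    (h : w ∈ ((P.takeUntil w hP).append (Q.takeUntil w hQ).reverse).support)
    (hx : x ∈ (((P.takeUntil w hP).append (Q.takeUntil w hQ).reverse).takeUntil w h).support)
    (hx' : x ∈ ((P.dropUntil w hP).reverse.append (Q.dropUntil w hQ)).support) : x = w := by
  rw [takeUntil_switch P Q hP hQ h] at hx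
  rw [Walk.mem_support_append_iff, Walk.support_reverse, List.mem_reverse] at hx'
  rcases hx' with h' | h'
  · exact eq_of_mem_support_takeUntil_of_mem_support_dropUntil hPp hP hx h'
  · exact hf x hx (Walk.support_dropUntil_subset_support _ _ h')

/-- Two first-meeting switches (of path pairs `(P, Q)`, `(P', Q')` at their first common vertices
`w`, `w'`) with the same outputs switch at the same vertex: both `w` and `w'` are the first vertex of
`out₁` on `out₂` (`first_mem_switch`), which is unique (`first_mem_unique`). [folklore] -/
theorem switch_vertex_eq {w w' : V} {P P' : H.Walk a c} {Q Q' : H.Walk b d} (hPp : P.IsPath)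
    (hPp' : P'.IsPath) (hP : w ∈ P.support) (hQ : w ∈ Q.support) (hP' : w' ∈ P'.support)
    (hQ' : w' ∈ Q'.support) (hf : ∀ x ∈ (P.takeUntil w hP).support, x ∈ Q.support → x = w)
    (hf' : ∀ x ∈ (P'.takeUntil w' hP').support, x ∈ Q'.support → x = w')
    (h₁ : (P.takeUntil w hP).append (Q.takeUntil w hQ).reverse =
      (P'.takeUntil w' hP').append (Q'.takeUntil w' hQ').reverse)
    (h₂ : (P.dropUntil w hP).reverse.append (Q.dropUntil w hQ) =
      (P'.dropUntil w' hP').reverse.append (Q'.dropUntil w' hQ')) : w = w' := by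
  have key : ∀ {R : H.Walk a b} {S : H.Walk c d},
      R = (P'.takeUntil w' hP').append (Q'.takeUntil w' hQ').reverse →
      S = (P'.dropUntil w' hP').reverse.append (Q'.dropUntil w' hQ') →
      ∃ hw' : w' ∈ R.support, w' ∈ S.support ∧
        ∀ x ∈ (R.takeUntil w' hw').support, x ∈ S.support → x = w' := by
    rintro _ _ rfl rfl
    exact ⟨(Walk.mem_support_append_iff _ _).2 (Or.inl (Walk.end_mem_support _)),
      (Walk.mem_support_append_iff _ _).2 (Or.inr (Walk.start_mem_support _)),
      fun x hx hx' => first_mem_switch hPp' hP' hQ' hf' _ hx hx'⟩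
  obtain ⟨hw', hl', hf''⟩ := key h₁ h₂
  exact first_mem_unique ((Walk.mem_support_append_iff _ _).2 (Or.inl (Walk.end_mem_support _))) hw'
    ((Walk.mem_support_append_iff _ _).2 (Or.inr (Walk.start_mem_support _))) hl'
    (fun x hx hx' => first_mem_switch hPp hP hQ hf _ hx hx') hf''

/-- The switch at a FIXED vertex `w` is injective on pairs `(P, Q)` with `|P|` prescribed: `P|→w` is the
initial segment of `out₁` up to `w` (`takeUntil_switch`), `Q|→w` follows by append-cancellation in
`out₁`, and `P|w→`, `Q|w→` by append-cancellation in `out₂` (the length `|P|w→| = |P| - |P|→w|` is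
known); finally `P = P|→w · P|w→` (`Walk.take_spec`). [folklore] -/
theorem switch_inj {w : V} {P P' : H.Walk a c} {Q Q' : H.Walk b d} (hlen : P.length = P'.length)
    (hP : w ∈ P.support) (hQ : w ∈ Q.support) (hP' : w ∈ P'.support) (hQ' : w ∈ Q'.support)
    (h₁ : (P.takeUntil w hP).append (Q.takeUntil w hQ).reverse =
      (P'.takeUntil w hP').append (Q'.takeUntil w hQ').reverse)
    (h₂ : (P.dropUntil w hP).reverse.append (Q.dropUntil w hQ) =
      (P'.dropUntil w hP').reverse.append (Q'.dropUntil w hQ')) : P = P' ∧ Q = Q' := by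
  have et : P.takeUntil w hP = P'.takeUntil w hP' := by
    have key : ∀ {R : H.Walk a b} (h : w ∈ R.support),
        R = (P'.takeUntil w hP').append (Q'.takeUntil w hQ').reverse →
        R.takeUntil w h = P'.takeUntil w hP' := by
      rintro _ h rfl
      exact takeUntil_switch P' Q' hP' hQ' h
    have hmem : w ∈ ((P.takeUntil w hP).append (Q.takeUntil w hQ).reverse).support :=
      (Walk.mem_support_append_iff _ _).2 (Or.inl (Walk.end_mem_support _))
    rw [← takeUntil_switch P Q hP hQ hmem]
    exact key hmem h₁
  rw [et] at h₁
  obtain ⟨-, eQt⟩ := walk_append_inj h₁ rfl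
  have eQt' : Q.takeUntil w hQ = Q'.takeUntil w hQ' := Walk.reverse_injective eQt
  have hPl : (P.takeUntil w hP).length + (P.dropUntil w hP).length = P.length := by
    rw [← Walk.length_append, Walk.take_spec]
  have hPl' : (P'.takeUntil w hP').length + (P'.dropUntil w hP').length = P'.length := by
    rw [← Walk.length_append, Walk.take_spec]
  have hdl : (P.dropUntil w hP).reverse.length = (P'.dropUntil w hP').reverse.length := by
    rw [Walk.length_reverse, Walk.length_reverse]
    have := congrArg Walk.length et
    omega
  obtain ⟨ePd, eQd⟩ := walk_append_inj h₂ hdl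
  have ePd' : P.dropUntil w hP = P'.dropUntil w hP' := Walk.reverse_injective ePd
  constructor
  · calc P = (P.takeUntil w hP).append (P.dropUntil w hP) := (P.take_spec hP).symm
      _ = (P'.takeUntil w hP').append (P'.dropUntil w hP') := by rw [et, ePd']
      _ = P' := P'.take_spec hP'
  · calc Q = (Q.takeUntil w hQ).append (Q.dropUntil w hQ) := (Q.take_spec hQ).symm
      _ = (Q'.takeUntil w hQ').append (Q'.dropUntil w hQ') := by rw [eQt', eQd]
      _ = Q' := Q'.take_spec hQ'

end Switch

/-- **Geodesic counts of an interlaced quadruple are TP₂** (any simple graph). If every self-avoiding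
path `p₁ → p₃` meets every self-avoiding path `p₂ → p₄` and the four-point inequality
`d₁₂ + d₃₄ ≤ d₁₃ + d₂₄` of `interlaced_dist_add_dist_le` is an equality, then the numbers
`N(a,b) = #{walks a → b of length dist a b}` of geodesics satisfy `N₁₃ · N₂₄ ≤ N₁₂ · N₃₄`: the
first-meeting switch `(P, Q) ↦ (P|→w · (Q|→w)⁻¹, (P|w→)⁻¹ · Q|w→)` is an injection of geodesic pairs
(`exists_first_mem`, `length_switch_add`, `switch_vertex_eq`, `switch_inj`, counted by
`Finset.card_le_card_of_forall_subsingleton`). This is the leading-`x`-coefficient comparison of the TP₂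
inequality of the crux in the equality case of the four-point condition. The reachability hypotheses
are not needed (without them both sides are computed from the same, possibly degenerate, finsets).
[folklore] -/
theorem interlaced_geodesicCount_mul_le [DecidableEq V] [H.LocallyFinite]
    (hI : Interlaced H p₁ p₂ p₃ p₄) (_h₁₃ : H.Reachable p₁ p₃) (_h₂₄ : H.Reachable p₂ p₄)
    (heq : H.dist p₁ p₃ + H.dist p₂ p₄ = H.dist p₁ p₂ + H.dist p₃ p₄) :
    (H.finsetWalkLength (H.dist p₁ p₃) p₁ p₃).card * (H.finsetWalkLength (H.dist p₂ p₄) p₂ p₄).card ≤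
      (H.finsetWalkLength (H.dist p₁ p₂) p₁ p₂).card *
        (H.finsetWalkLength (H.dist p₃ p₄) p₃ p₄).card := by
  rw [← Finset.card_product, ← Finset.card_product]
  refine Finset.card_le_card_of_forall_subsingleton
    (fun (x : H.Walk p₁ p₃ × H.Walk p₂ p₄) (y : H.Walk p₁ p₂ × H.Walk p₃ p₄) =>
      ∃ (w : V) (hP : w ∈ x.1.support) (hQ : w ∈ x.2.support),
        (∀ v ∈ (x.1.takeUntil w hP).support, v ∈ x.2.support → v = w) ∧
          y = ((x.1.takeUntil w hP).append (x.2.takeUntil w hQ).reverse,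
            (x.1.dropUntil w hP).reverse.append (x.2.dropUntil w hQ)))
    ?_ ?_
  · rintro ⟨P, Q⟩ hPQ
    simp only [Finset.mem_product, mem_finsetWalkLength_iff] at hPQ
    obtain ⟨hPl, hQl⟩ := hPQ
    obtain ⟨v, hvP, hvQ⟩ :=
      hI ⟨P, P.isPath_of_length_eq_dist hPl⟩ ⟨Q, Q.isPath_of_length_eq_dist hQl⟩
    obtain ⟨w, hw, hwQ, hf⟩ := exists_first_mem P Q.support hvP hvQ
    refine ⟨((P.takeUntil w hw).append (Q.takeUntil w hwQ).reverse,
      (P.dropUntil w hw).reverse.append (Q.dropUntil w hwQ)), ?_, w, hw, hwQ, hf, rfl⟩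
    simp only [Finset.mem_product, mem_finsetWalkLength_iff]
    have hsum := length_switch_add P Q hw hwQ
    have hd₁ := dist_le ((P.takeUntil w hw).append (Q.takeUntil w hwQ).reverse)
    have hd₂ := dist_le ((P.dropUntil w hw).reverse.append (Q.dropUntil w hwQ))
    rw [hPl, hQl, heq] at hsum
    constructor <;> omega
  · rintro ⟨R₁, R₂⟩ - ⟨P, Q⟩ hPQ ⟨P', Q'⟩ hPQ'
    simp only [Set.mem_setOf_eq, Finset.mem_product, mem_finsetWalkLength_iff, Prod.mk.injEq]
      at hPQ hPQ'
    obtain ⟨⟨hPl, -⟩, w, hP, hQ, hf, rfl, rfl⟩ := hPQ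
    obtain ⟨⟨hPl', -⟩, w', hP', hQ', hf', h₁, h₂⟩ := hPQ'
    obtain rfl : w = w' := switch_vertex_eq (P.isPath_of_length_eq_dist hPl)
      (P'.isPath_of_length_eq_dist hPl') hP hQ hP' hQ' hf hf' h₁ h₂
    obtain ⟨rfl, rfl⟩ := switch_inj (hPl.trans hPl'.symm) hP hQ hP' hQ' h₁ h₂
    rfl

end Summit.CriticalPhenomena.SAWScalingLimit.Theorems.BoundaryTP2
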